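import Mathlib.RingTheory.MvPolynomial.IrreducibleQuadratic
import Mathlib.RingTheory.MvPolynomial.Ideal
import Literature.Computability.AlgebraicComplexity.LS00TwoByTwoPermanentalIdeals
import HarnessLib

/-!
# Laubenbacher–Swanson 2000, Theorem 4.1 (second half): the minimal primes of `P₂(M)`

Topic `Literature/Computability/AlgebraicComplexity`; theorem-only file (no definitions, no named
facts), sibling of `LS00TwoByTwoPermanentalIdeals` (Lemma 2.1, Thm. 4.1 first half, heights).
Source: R. C. Laubenbacher, I. Swanson, *Permanental ideals*, J. Symbolic Comput. 30 (2000)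
195–205, arXiv:math/9812112 (held; unnumbered statement heads in the arXiv text — Theorem 4.1 =
p0006 L9–22, its proof L24–105, Remark 4.2 = p0006 L106–112).  `F` a field with `2 ≠ 0` where
needed (the paper: characteristic `≠ 2`); `P₂(M) = BoraleviCarliniMichalekVentura2025.subpermIdeal
F m n 2`.  The three TYPES of ideals of Thm. 4.1 are written inline as spans (no definitions):

* type (1), row `r`:    `Ideal.span (X '' {x | x.1 ≠ r})` — "all the indeterminates in `m − 1`
  of the rows of `M`";
* type (2), column `c`: `Ideal.span (X '' {x | x.2 ≠ c})`;
* type (3), block `{r, s} × {c, d}` (`r ≠ s`, `c ≠ d`):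
  `Ideal.span (insert (x_{rc} x_{sd} + x_{rd} x_{sc}) (X '' {x | ¬((x.1 = r ∨ x.1 = s) ∧ (x.2 = c ∨ x.2 = d))}))`
  — "the permanent of one `2 × 2`-submatrix of `M` and all the entries of `M` outside of this
  submatrix".

## What is typed

* Kill-variables maps (private plumbing: `sub_kill_mem_span` — `f − φ_S f ∈ (x_p : p ∈ S)`,
  `ker_kill_eq_span`, `X_mem_span_X_image_iff`) and `isPrime_span_X_image`: the ideal of any
  set of variables is prime (types (1), (2)).
* `prime_blockPerm`: `x_{rc} x_{sd} + x_{rd} x_{sc}` is a prime element (`r ≠ s`, `c ≠ d`; Mathlib's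
  `MvPolynomial.irreducible_mul_X_add` + UFD), `isPrime_blockIdeal` (type (3) is prime, as the
  pull-back of `(per)` under the kill map of the off-block variables — private
  `blockIdeal_eq_comap`), `X_notMem_blockIdeal` (the four block variables are not in it).
* `subpermIdeal_two_le_of_pairs`, `subpermIdeal_two_le_rowIdeal`, `…_le_colIdeal`,
  `…_le_blockIdeal`: the type ideals contain `P₂(M)`.
* **Theorem 4.1, second half** ("Moreover, each of the primes in (1), (2) and (3) is minimal over
  `P₂(M)`", with the printed provisos "(1) if `n ≥ 3`", "(2) if `m ≥ 3`"):
  `rowIdeal_mem_minimalPrimes` (`n ≥ 3`), `colIdeal_mem_minimalPrimes` (`m ≥ 3`),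
  `blockIdeal_mem_minimalPrimes` (`m, n ≥ 2`) — by containment combinatorics on top of the first
  half `thm_4_1_contains` — and the full classification `thm_4_1`:
  for `m, n ≥ 2` and `2 ≠ 0` in `F`, `Q ∈ minimalPrimes P₂(M)` iff `Q` is of type (1) with
  `n ≥ 3`, or of type (2) with `m ≥ 3`, or of type (3).
* **Remark 4.2, type (3) exact**: `rem_4_2_block` — the type (3) ideal has height `mn − 3`
  (Krull above; `rem_4_2_block_ge` of the sibling file below).
* **Corollary 4.3** in the two-heights form (no `equidimensional` notion in the tree) with the
  CORRECTED exception list `(m,n) ∉ {(2,2), (3,3), (2,3), (3,2)}` (`cor_4_3`), together with the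
  kernel witness `cor_4_3_asPrinted_counterexample` that the printed list "`(m,n) ≠ (2,2), (3,3)`"
  (arXiv text p0006 L120–125) is insufficient: at `(2, 3)` every minimal prime has height `3`.
  Typed ≠ printed; flagged for the PRINT-ERRATA registry (candidate A48, Tier B — a side remark;
  Thm. 4.1 / Rem. 4.2 / Cor. 4.4 unaffected).

## What is NOT typed

* Corollary 4.3's clause "hence not Cohen–Macaulay"; Corollary 4.4 (the number of minimal
  components, `m + n + C(m,2) C(n,2)` for `m, n ≥ 3` etc. — it needs the injectivity of the type
  parametrisation, more than a short corollary); §3, §5.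
* The paper's inductive proof (p0006 L62–105) is replaced by the support trichotomy at the generic
  point (`thm_4_1_contains`); the statements are the printed ones.

Honest framing: V0 dictionary (commutative algebra of `P₂(M)`); no rung of any route moves; VP ≠ VNP
is NOT proved.
-/

noncomputable section

open Matrix MvPolynomial Finset

namespace Literature.Computability.AlgebraicComplexity

namespace LaubenbacherSwanson2000

open VonZurGathen BoraleviCarliniMichalekVentura2025

/-! ### §A. Killing a set of variables -/

section Kill

variable {F : Type*} [CommRing F] {σ : Type*}

/-- **Congruence of the kill map**: for `φ_S = (x_p ↦ 0 for p ∈ S, x_p ↦ x_p otherwise)`,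
`f − φ_S(f)` lies in the ideal `(x_p : p ∈ S)`. [folklore] -/
private theorem sub_kill_mem_span (S : Set σ) [DecidablePred (· ∈ S)] (f : MvPolynomial σ F) :
    f - aeval (fun x => if x ∈ S then (0 : MvPolynomial σ F) else X x) f ∈
      Ideal.span ((fun x => (X x : MvPolynomial σ F)) '' S) := by
  induction f using MvPolynomial.induction_on with
  | C a => simp
  | add p q hp hq =>
    have e : p + q - aeval (fun x => if x ∈ S then (0 : MvPolynomial σ F) else X x) (p + q) =
        (p - aeval (fun x => if x ∈ S then (0 : MvPolynomial σ F) else X x) p) +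
          (q - aeval (fun x => if x ∈ S then (0 : MvPolynomial σ F) else X x) q) := by
      rw [map_add]; ring
    rw [e]
    exact Ideal.add_mem _ hp hq
  | mul_X p x hp =>
    by_cases hx : x ∈ S
    · have e : p * X x - aeval (fun x => if x ∈ S then (0 : MvPolynomial σ F) else X x)
          (p * X x) = p * X x := by
        rw [map_mul, aeval_X, if_pos hx, mul_zero, sub_zero]
      rw [e]
      exact Ideal.mul_mem_left _ _ (Ideal.subset_span ⟨x, hx, rfl⟩)
    · have e : p * X x - aeval (fun x => if x ∈ S then (0 : MvPolynomial σ F) else X x)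
          (p * X x) =
          (p - aeval (fun x => if x ∈ S then (0 : MvPolynomial σ F) else X x) p) * X x := by
        rw [map_mul, aeval_X, if_neg hx]; ring
      rw [e]
      exact Ideal.mul_mem_right _ _ hp

/-- The kill map kills the variables of `S`. [folklore] -/
private theorem kill_X_of_mem (S : Set σ) [DecidablePred (· ∈ S)] {x : σ} (hx : x ∈ S) :
    aeval (fun x => if x ∈ S then (0 : MvPolynomial σ F) else X x) (X x : MvPolynomial σ F) = 0 := by
  rw [aeval_X, if_pos hx]

/-- The kill map fixes the other variables. [folklore] -/
private theorem kill_X_of_notMem (S : Set σ) [DecidablePred (· ∈ S)] {x : σ} (hx : x ∉ S) :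
    aeval (fun x => if x ∈ S then (0 : MvPolynomial σ F) else X x) (X x : MvPolynomial σ F) =
      X x := by
  rw [aeval_X, if_neg hx]

/-- **The ideal of a set of variables is the kernel of the kill map.** [folklore] -/
private theorem ker_kill_eq_span (S : Set σ) [DecidablePred (· ∈ S)] :
    RingHom.ker (aeval (R := F) (fun x => if x ∈ S then (0 : MvPolynomial σ F) else X x)) =
      Ideal.span ((fun x => (X x : MvPolynomial σ F)) '' S) := by
  apply le_antisymm
  · intro f hf
    rw [RingHom.mem_ker] at hf
    have h := sub_kill_mem_span S f
    rwa [show aeval (fun x => if x ∈ S then (0 : MvPolynomial σ F) else X x) f = 0 from hf,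
      sub_zero] at h
  · rw [Ideal.span_le]
    rintro g ⟨x, hx, rfl⟩
    rw [SetLike.mem_coe, RingHom.mem_ker]
    exact kill_X_of_mem S hx

/-- **Ideals generated by variables are prime** (over a domain): types (1) and (2) of
Laubenbacher–Swanson's Thm. 4.1 are prime ideals. [cite: LaubenbacherSwanson2000, Thm. 4.1 (arXiv text p0006 L9–22)] -/
theorem isPrime_span_X_image [IsDomain F] (S : Set σ) :
    (Ideal.span ((fun x => (X x : MvPolynomial σ F)) '' S)).IsPrime := by
  classical
  rw [← ker_kill_eq_span S]
  exact RingHom.ker_isPrime _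

/-- A variable lies in the ideal of the variables of `S` iff it is one of them (`F` nontrivial).
[folklore] -/
private theorem X_mem_span_X_image_iff [Nontrivial F] (S : Set σ) (x : σ) :
    (X x : MvPolynomial σ F) ∈ Ideal.span ((fun x => (X x : MvPolynomial σ F)) '' S) ↔ x ∈ S := by
  classical
  constructor
  · intro h
    have h' := (MvPolynomial.mem_ideal_span_X_image.1 h) (Finsupp.single x 1)
      (by rw [MvPolynomial.support_X]; exact Finset.mem_singleton_self _)
    obtain ⟨i, hi, hne⟩ := h'
    rw [Finsupp.single_apply] at hne
    by_cases hix : x = i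
    · rw [hix]; exact hi
    · exact absurd (if_neg hix) hne
  · exact fun h => Ideal.subset_span ⟨x, h, rfl⟩

end Kill

/-! ### §B. The block permanent is prime; the type (3) ideal -/

section Block

variable {F : Type*} [Field F] {m n : ℕ}

/-- **The `2 × 2` permanent `x_{rc} x_{sd} + x_{rd} x_{sc}` (`r ≠ s`, `c ≠ d`) is a prime element**
of `F[X_{m×n}]`: irreducible by Mathlib's `MvPolynomial.irreducible_mul_X_add` (it is
`x_{rc} · x_{sd} + x_{rd} x_{sc}` with `x_{sd}` absent from `x_{rc}` and from `x_{rd} x_{sc}`, and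
`x_{rc}` relatively prime to `x_{rd} x_{sc}`), hence prime (UFD). LS: "it is easy to see that
`P₂(M)` is prime" (`m = n = 2`). [cite: LaubenbacherSwanson2000, Thm. 4.1, proof (arXiv text p0006 L25–26)] -/
theorem prime_blockPerm {r s : Fin m} {c d : Fin n} (hrs : r ≠ s) (hcd : c ≠ d) :
    Prime (X (r, c) * X (s, d) + X (r, d) * X (s, c) : MvPolynomial (Fin m × Fin n) F) := by
  classical
  have hirr : Irreducible
      (X (r, c) * X (s, d) + X (r, d) * X (s, c) : MvPolynomial (Fin m × Fin n) F) := by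
    refine MvPolynomial.irreducible_mul_X_add (X (r, c)) (X (r, d) * X (s, c)) (s, d)
      (X_ne_zero _) ?_ ?_ ?_
    · rw [vars_X, Finset.mem_singleton, Prod.mk.injEq]
      exact fun h => hrs h.1.symm
    · intro h
      have h' := vars_mul (X (r, d) : MvPolynomial (Fin m × Fin n) F) (X (s, c)) h
      rw [Finset.mem_union, vars_X, vars_X, Finset.mem_singleton, Finset.mem_singleton,
        Prod.mk.injEq, Prod.mk.injEq] at h'
      rcases h' with h' | h'
      · exact hrs h'.1.symm
      · exact hcd h'.2.symm
    · intro e he1 he2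
      obtain ⟨u, hu, he⟩ := dvd_X_iff_exists.1 he1
      rcases he with he | he
      · rw [he]; exact hu.map C
      · -- `u • x_{rc} ∣ x_{rd} x_{sc}` is absurd: evaluate at `x_{rc} = 0`, all other variables `1`
        exfalso
        rw [he] at he2
        let δ : Fin m × Fin n → F := fun x => if x = (r, c) then 0 else 1
        have h0 : MvPolynomial.eval δ (X (r, c) : MvPolynomial (Fin m × Fin n) F) = 0 := by
          rw [eval_X]; exact if_pos rfl
        have h1 : MvPolynomial.eval δ (X (r, d) : MvPolynomial (Fin m × Fin n) F) = 1 := by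
          rw [eval_X]
          exact if_neg fun h => hcd (congrArg Prod.snd h).symm
        have h1' : MvPolynomial.eval δ (X (s, c) : MvPolynomial (Fin m × Fin n) F) = 1 := by
          rw [eval_X]
          exact if_neg fun h => hrs (congrArg Prod.fst h).symm
        have h2 := map_dvd (MvPolynomial.eval δ) he2
        rw [smul_eq_C_mul, map_mul, map_mul, eval_C, h0, h1, h1', mul_zero, mul_one,
          zero_dvd_iff] at h2
        exact one_ne_zero h2
  exact UniqueFactorizationMonoid.irreducible_iff_prime.1 hirr

/-- The kill map of the off-block positions fixes the block permanent. [folklore] -/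
private theorem kill_blockPerm {r s : Fin m} {c d : Fin n} :
    aeval (fun x : Fin m × Fin n =>
        if x ∈ ({x | ¬((x.1 = r ∨ x.1 = s) ∧ (x.2 = c ∨ x.2 = d))} : Set (Fin m × Fin n)) then
          (0 : MvPolynomial (Fin m × Fin n) F) else X x)
      (X (r, c) * X (s, d) + X (r, d) * X (s, c) : MvPolynomial (Fin m × Fin n) F) =
      X (r, c) * X (s, d) + X (r, d) * X (s, c) := by
  simp only [map_add, map_mul, aeval_X, Set.mem_setOf_eq, true_or, or_true, and_self,
    not_true_eq_false, if_false]

/-- **The type (3) ideal is the pull-back of `(per)` under the kill map of the off-block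
variables.** [folklore] -/
private theorem blockIdeal_eq_comap {r s : Fin m} {c d : Fin n} :
    Ideal.span (insert (X (r, c) * X (s, d) + X (r, d) * X (s, c) : MvPolynomial (Fin m × Fin n) F)
      ((fun x => (X x : MvPolynomial (Fin m × Fin n) F)) ''
        {x | ¬((x.1 = r ∨ x.1 = s) ∧ (x.2 = c ∨ x.2 = d))})) =
    (Ideal.span {(X (r, c) * X (s, d) + X (r, d) * X (s, c) :
        MvPolynomial (Fin m × Fin n) F)}).comap
      (aeval (R := F) (fun x : Fin m × Fin n =>
        if x ∈ ({x | ¬((x.1 = r ∨ x.1 = s) ∧ (x.2 = c ∨ x.2 = d))} : Set (Fin m × Fin n)) then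
          (0 : MvPolynomial (Fin m × Fin n) F) else X x)).toRingHom := by
  have hφper := kill_blockPerm (F := F) (r := r) (s := s) (c := c) (d := d)
  apply le_antisymm
  · rw [Ideal.span_le]
    rintro g (rfl | ⟨x, hx, rfl⟩)
    · rw [SetLike.mem_coe, Ideal.mem_comap, AlgHom.toRingHom_eq_coe, RingHom.coe_coe, hφper]
      exact Ideal.subset_span rfl
    · rw [SetLike.mem_coe, Ideal.mem_comap, AlgHom.toRingHom_eq_coe, RingHom.coe_coe,
        kill_X_of_mem _ hx]
      exact Ideal.zero_mem _
  · intro f hf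
    rw [Ideal.mem_comap, AlgHom.toRingHom_eq_coe, RingHom.coe_coe] at hf
    have h1 := Ideal.span_mono (Set.subset_insert
      (X (r, c) * X (s, d) + X (r, d) * X (s, c) : MvPolynomial (Fin m × Fin n) F) _)
      (sub_kill_mem_span ({x | ¬((x.1 = r ∨ x.1 = s) ∧ (x.2 = c ∨ x.2 = d))} :
        Set (Fin m × Fin n)) f)
    have h2 := Ideal.span_mono (Set.singleton_subset_iff.2 (Set.mem_insert
      (X (r, c) * X (s, d) + X (r, d) * X (s, c) : MvPolynomial (Fin m × Fin n) F)
      ((fun x => (X x : MvPolynomial (Fin m × Fin n) F)) ''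
        {x | ¬((x.1 = r ∨ x.1 = s) ∧ (x.2 = c ∨ x.2 = d))}))) hf
    have h := Ideal.add_mem _ h1 h2
    rwa [sub_add_cancel] at h

/-- **The type (3) ideal is prime.** [cite: LaubenbacherSwanson2000, Thm. 4.1 (arXiv text p0006 L9–22)] -/
theorem isPrime_blockIdeal {r s : Fin m} {c d : Fin n} (hrs : r ≠ s) (hcd : c ≠ d) :
    (Ideal.span (insert (X (r, c) * X (s, d) + X (r, d) * X (s, c) :
        MvPolynomial (Fin m × Fin n) F)
      ((fun x => (X x : MvPolynomial (Fin m × Fin n) F)) ''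
        {x | ¬((x.1 = r ∨ x.1 = s) ∧ (x.2 = c ∨ x.2 = d))}))).IsPrime := by
  rw [blockIdeal_eq_comap]
  haveI : (Ideal.span {(X (r, c) * X (s, d) + X (r, d) * X (s, c) :
      MvPolynomial (Fin m × Fin n) F)}).IsPrime :=
    (Ideal.span_singleton_prime (prime_blockPerm (F := F) hrs hcd).ne_zero).2
      (prime_blockPerm hrs hcd)
  exact Ideal.comap_isPrime _ _

/-- **The block variables are not in the type (3) ideal**: for a position `x` of the block,
`X x ∉` the type (3) ideal (else `per ∣ X x`, absurd by evaluation) — the substance of LS's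
"the three types of primes in Theorem 4.1 satisfy no inclusion relations".
[cite: LaubenbacherSwanson2000, Rem. 4.2 (arXiv text p0006 L106–107)] -/
theorem X_notMem_blockIdeal {r s : Fin m} {c d : Fin n} (hrs : r ≠ s) (hcd : c ≠ d)
    {x : Fin m × Fin n} (hx : (x.1 = r ∨ x.1 = s) ∧ (x.2 = c ∨ x.2 = d)) :
    (X x : MvPolynomial (Fin m × Fin n) F) ∉
      Ideal.span (insert (X (r, c) * X (s, d) + X (r, d) * X (s, c) :
          MvPolynomial (Fin m × Fin n) F)
        ((fun x => (X x : MvPolynomial (Fin m × Fin n) F)) ''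
          {x | ¬((x.1 = r ∨ x.1 = s) ∧ (x.2 = c ∨ x.2 = d))})) := by
  classical
  intro h
  rw [blockIdeal_eq_comap, Ideal.mem_comap, AlgHom.toRingHom_eq_coe, RingHom.coe_coe,
    kill_X_of_notMem _ (by intro h'; simp only [Set.mem_setOf_eq] at h'; exact h' hx),
    Ideal.mem_span_singleton] at h
  -- `per ∣ X x`: then `per = C u` or `per = u • X x`
  obtain ⟨u, hu, he⟩ := dvd_X_iff_exists.1 h
  rcases he with he | he
  · have h0 := congrArg (MvPolynomial.eval fun _ : Fin m × Fin n => (0 : F)) he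
    simp only [map_add, map_mul, eval_X, mul_zero, add_zero, eval_C] at h0
    exact hu.ne_zero h0.symm
  · -- evaluate at `x ↦ 0`, every other variable `↦ 1`: `per ↦ 1`, `u • X x ↦ 0`
    have h1 := congrArg (MvPolynomial.eval fun y : Fin m × Fin n => if y = x then (0 : F) else 1) he
    have hX : MvPolynomial.eval (fun y : Fin m × Fin n => if y = x then (0 : F) else 1)
        (X x : MvPolynomial (Fin m × Fin n) F) = 0 := by rw [eval_X]; exact if_pos rfl
    rw [smul_eq_C_mul, map_mul, eval_C, hX, mul_zero, map_add, map_mul, map_mul, eval_X, eval_X,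
      eval_X, eval_X] at h1
    obtain ⟨x1, x2⟩ := x
    simp only [Prod.mk.injEq] at h1 hx
    rcases hx with ⟨h1' | h1', h2' | h2'⟩ <;> subst h1' <;> subst h2' <;>
      simp [hrs, hrs.symm, hcd, hcd.symm] at h1

end Block

/-! ### §C. The type ideals contain `P₂(M)` -/

section Contain

variable (F : Type*) [Field F] {m n : ℕ}

/-- `P₂(M) ≤ J` as soon as `J` contains every written-out `2 × 2` permanent
`x_{ri} x_{sj} + x_{rj} x_{si}` (`r ≠ s`, `i ≠ j`) — the generators of `P₂(M)`.
[cite: LaubenbacherSwanson2000, §1 (definition of `P_r(M)`, arXiv text p0002 L36–41)] -/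
theorem subpermIdeal_two_le_of_pairs (J : Ideal (MvPolynomial (Fin m × Fin n) F))
    (h : ∀ (r s : Fin m) (i j : Fin n), r ≠ s → i ≠ j →
      (X (r, i) * X (s, j) + X (r, j) * X (s, i) : MvPolynomial (Fin m × Fin n) F) ∈ J) :
    subpermIdeal F m n 2 ≤ J := by
  classical
  refine subpermIdeal_le_iff.2 fun Rw Cl hR hC => ?_
  obtain ⟨r, s, hrs, rfl⟩ := Finset.card_eq_two.1 hR
  obtain ⟨i, j, hij, rfl⟩ := Finset.card_eq_two.1 hC
  rw [rsubperm_pair _ hrs hij]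
  simpa only [Matrix.mvPolynomialX_apply] using h r s i j hrs hij

/-- The type (1) ideal of the row `r` contains `P₂(M)` (every `2 × 2` permanent uses a second
row). [cite: LaubenbacherSwanson2000, Thm. 4.1 (arXiv text p0006 L9–22)] -/
theorem subpermIdeal_two_le_rowIdeal (r : Fin m) :
    subpermIdeal F m n 2 ≤
      Ideal.span ((fun x => (X x : MvPolynomial (Fin m × Fin n) F)) '' {x | x.1 ≠ r}) := by
  refine subpermIdeal_two_le_of_pairs F _ fun r' s i j hrs _ => ?_
  by_cases h : r' = r
  · have hs : s ≠ r := fun hs => hrs (h.trans hs.symm)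
    exact Ideal.add_mem _ (Ideal.mul_mem_left _ _ (Ideal.subset_span ⟨(s, j), hs, rfl⟩))
      (Ideal.mul_mem_left _ _ (Ideal.subset_span ⟨(s, i), hs, rfl⟩))
  · exact Ideal.add_mem _ (Ideal.mul_mem_right _ _ (Ideal.subset_span ⟨(r', i), h, rfl⟩))
      (Ideal.mul_mem_right _ _ (Ideal.subset_span ⟨(r', j), h, rfl⟩))

/-- The type (2) ideal of the column `c` contains `P₂(M)`. [cite: LaubenbacherSwanson2000, Thm. 4.1 (arXiv text p0006 L9–22)] -/
theorem subpermIdeal_two_le_colIdeal (c : Fin n) :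
    subpermIdeal F m n 2 ≤
      Ideal.span ((fun x => (X x : MvPolynomial (Fin m × Fin n) F)) '' {x | x.2 ≠ c}) := by
  refine subpermIdeal_two_le_of_pairs F _ fun r s i j _ hij => ?_
  by_cases h : i = c
  · have hj : j ≠ c := fun hj => hij (h.trans hj.symm)
    exact Ideal.add_mem _ (Ideal.mul_mem_left _ _ (Ideal.subset_span ⟨(s, j), hj, rfl⟩))
      (Ideal.mul_mem_right _ _ (Ideal.subset_span ⟨(r, j), hj, rfl⟩))
  · exact Ideal.add_mem _ (Ideal.mul_mem_right _ _ (Ideal.subset_span ⟨(r, i), h, rfl⟩))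
      (Ideal.mul_mem_left _ _ (Ideal.subset_span ⟨(s, i), h, rfl⟩))

/-- The type (3) ideal of the block `{r, s} × {c, d}` contains `P₂(M)`: the block permanent is a
generator, and every other `2 × 2` permanent has an off-block variable in each monomial.
[cite: LaubenbacherSwanson2000, Thm. 4.1 (arXiv text p0006 L9–22)] -/
theorem subpermIdeal_two_le_blockIdeal {r s : Fin m} {c d : Fin n} :
    subpermIdeal F m n 2 ≤
      Ideal.span (insert (X (r, c) * X (s, d) + X (r, d) * X (s, c) :
          MvPolynomial (Fin m × Fin n) F)
        ((fun x => (X x : MvPolynomial (Fin m × Fin n) F)) ''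
          {x | ¬((x.1 = r ∨ x.1 = s) ∧ (x.2 = c ∨ x.2 = d))})) := by
  classical
  set J := Ideal.span (insert (X (r, c) * X (s, d) + X (r, d) * X (s, c) :
      MvPolynomial (Fin m × Fin n) F)
    ((fun x => (X x : MvPolynomial (Fin m × Fin n) F)) ''
      {x | ¬((x.1 = r ∨ x.1 = s) ∧ (x.2 = c ∨ x.2 = d))})) with hJ
  have hoff : ∀ x : Fin m × Fin n, ¬((x.1 = r ∨ x.1 = s) ∧ (x.2 = c ∨ x.2 = d)) →
      (X x : MvPolynomial (Fin m × Fin n) F) ∈ J :=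
    fun x hx => Ideal.subset_span (Set.mem_insert_of_mem _ ⟨x, hx, rfl⟩)
  have hper : (X (r, c) * X (s, d) + X (r, d) * X (s, c) : MvPolynomial (Fin m × Fin n) F) ∈ J :=
    Ideal.subset_span (Set.mem_insert _ _)
  -- a monomial `X x * X y` with `x` or `y` off the block lies in `J`
  have hmono : ∀ x y : Fin m × Fin n,
      ¬((x.1 = r ∨ x.1 = s) ∧ (x.2 = c ∨ x.2 = d)) ∨ ¬((y.1 = r ∨ y.1 = s) ∧ (y.2 = c ∨ y.2 = d)) →
      (X x * X y : MvPolynomial (Fin m × Fin n) F) ∈ J := by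
    rintro x y (h | h)
    · exact Ideal.mul_mem_right _ _ (hoff x h)
    · exact Ideal.mul_mem_left _ _ (hoff y h)
  refine subpermIdeal_two_le_of_pairs F J fun r' s' i j hrs hij => ?_
  -- either both monomials touch the outside, or the `2 × 2` submatrix is the block itself
  by_cases hin : ((r' = r ∨ r' = s) ∧ (i = c ∨ i = d)) ∧ ((s' = r ∨ s' = s) ∧ (j = c ∨ j = d)) ∧
      ((r' = r ∨ r' = s) ∧ (j = c ∨ j = d)) ∧ ((s' = r ∨ s' = s) ∧ (i = c ∨ i = d))
  · -- the submatrix is the block: `{r', s'} = {r, s}`, `{i, j} = {c, d}`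
    obtain ⟨⟨hr', hi⟩, ⟨hs', hj⟩, -, -⟩ := hin
    have key : ∀ (a b : Fin m) (p q : Fin n), (a = r ∨ a = s) → (b = r ∨ b = s) → a ≠ b →
        (p = c ∨ p = d) → (q = c ∨ q = d) → p ≠ q →
        (X (a, p) * X (b, q) + X (a, q) * X (b, p) : MvPolynomial (Fin m × Fin n) F) ∈ J := by
      intro a b p q ha hb hab hp hq hpq
      have e : (X (a, p) * X (b, q) + X (a, q) * X (b, p) : MvPolynomial (Fin m × Fin n) F) =
          X (r, c) * X (s, d) + X (r, d) * X (s, c) := by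
        rcases ha with ha | ha <;> rcases hb with hb | hb <;> rcases hp with hp | hp <;>
          rcases hq with hq | hq <;> rw [ha, hb, hp, hq] <;>
          first
          | exact absurd (ha.trans hb.symm) hab
          | exact absurd (hp.trans hq.symm) hpq
          | ring
      rw [e]; exact hper
    exact key r' s' i j hr' hs' hrs hi hj hij
  · -- some monomial factor is off the block, in each of the two monomials
    by_cases h1 : (r' = r ∨ r' = s) ∧ (i = c ∨ i = d)
    · by_cases h2 : (s' = r ∨ s' = s) ∧ (j = c ∨ j = d)
      · -- then `(r', j)` and `(s', i)` are in the block too: contradiction with `hin`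
        exact (hin ⟨h1, h2, ⟨h1.1, h2.2⟩, ⟨h2.1, h1.2⟩⟩).elim
      · -- `(s', j)` off; and one of `(r', j)`, `(s', i)` off
        refine Ideal.add_mem _ (hmono _ _ (Or.inr h2)) ?_
        by_cases h3 : (r' = r ∨ r' = s) ∧ (j = c ∨ j = d)
        · exact hmono _ _ (Or.inr fun h4 => h2 ⟨h4.1, h3.2⟩)
        · exact hmono _ _ (Or.inl h3)
    · refine Ideal.add_mem _ (hmono _ _ (Or.inl h1)) ?_
      by_cases h3 : (r' = r ∨ r' = s) ∧ (j = c ∨ j = d)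
      · exact hmono _ _ (Or.inr fun h4 => h1 ⟨h3.1, h4.2⟩)
      · exact hmono _ _ (Or.inl h3)

end Contain

/-! ### §D. Theorem 4.1, second half: the type ideals are minimal primes; classification -/

section Minimal

variable (F : Type*) [Field F] {m n : ℕ}

/-- Two indices avoid a third when `n ≥ 3`. [folklore] -/
private theorem exists_ne_ne_of_three_le (hn : 3 ≤ n) (a b : Fin n) :
    ∃ j : Fin n, j ≠ a ∧ j ≠ b := by
  classical
  have hcard : 1 ≤ ((Finset.univ.erase a).erase b).card := by
    have h1 := Finset.pred_card_le_card_erase (s := Finset.univ.erase a) (a := b)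
    have h2 := Finset.pred_card_le_card_erase (s := (Finset.univ : Finset (Fin n))) (a := a)
    rw [Finset.card_univ, Fintype.card_fin] at h2
    omega
  obtain ⟨j, hj⟩ := Finset.card_pos.1 (lt_of_lt_of_le zero_lt_one hcard)
  exact ⟨j, (Finset.mem_erase.1 (Finset.mem_erase.1 hj).2).1, (Finset.mem_erase.1 hj).1⟩

/-- An index avoiding a given one when `n ≥ 2`. [folklore] -/
private theorem exists_ne_of_two_le (hn : 2 ≤ n) (a : Fin n) : ∃ j : Fin n, j ≠ a := by
  haveI : Nontrivial (Fin n) := Fin.nontrivial_iff_two_le.2 hn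
  exact exists_ne a

/-- In `Fin 2`… : when `n = 2` every index is `0` or `1`. [folklore] -/
private theorem eq_or_eq_of_eq_two (hn : n = 2) (j : Fin n) :
    j = ⟨0, by omega⟩ ∨ j = ⟨1, by omega⟩ := by
  have h : j.val = 0 ∨ j.val = 1 := by have := j.isLt; omega
  rcases h with h | h
  · exact Or.inl (Fin.ext h)
  · exact Or.inr (Fin.ext h)

variable {F} in
/-- The written-out `2 × 2` permanent of a submatrix with the same rows and columns as the block
`{r, s} × {c, d}` IS the block permanent. [folklore] -/
private theorem blockPerm_eq_of_mem {r s a b : Fin m} {c d p q : Fin n} (ha : a = r ∨ a = s)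
    (hb : b = r ∨ b = s) (hab : a ≠ b) (hp : p = c ∨ p = d) (hq : q = c ∨ q = d) (hpq : p ≠ q) :
    (X (a, p) * X (b, q) + X (a, q) * X (b, p) : MvPolynomial (Fin m × Fin n) F) =
      X (r, c) * X (s, d) + X (r, d) * X (s, c) := by
  rcases ha with ha | ha <;> rcases hb with hb | hb <;> rcases hp with hp | hp <;>
    rcases hq with hq | hq <;> rw [ha, hb, hp, hq] <;>
    first
    | exact absurd (ha.trans hb.symm) hab
    | exact absurd (hp.trans hq.symm) hpq
    | ring

/-- **Laubenbacher–Swanson 2000, Thm. 4.1, second half, type (1)** ("(1) If `n ≥ 3`, then `P` is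
generated by all the indeterminates in `m − 1` of the rows of `M` … Moreover, each of the primes in
(1), (2) and (3) is minimal over `P₂(M)`"): for `n ≥ 3` (and `2 ≠ 0` in `F`) the ideal of the
variables off the row `r` is a minimal prime of `P₂(M)`.  (For `n = 2` it is not: it strictly
contains the type (3) ideal of the block `{r, s} × {0, 1}`.)
[cite: LaubenbacherSwanson2000, Thm. 4.1 (arXiv text p0006 L9–22)] -/
theorem rowIdeal_mem_minimalPrimes (h2 : (2 : F) ≠ 0) (hm : 1 ≤ m) (hn : 3 ≤ n) (r : Fin m) :
    Ideal.span ((fun x => (X x : MvPolynomial (Fin m × Fin n) F)) '' {x | x.1 ≠ r}) ∈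
      (subpermIdeal F m n 2).minimalPrimes := by
  classical
  refine ⟨⟨isPrime_span_X_image _, subpermIdeal_two_le_rowIdeal F r⟩, ?_⟩
  rintro P ⟨hP, hle⟩ hPle
  haveI := hP
  have hnot : ∀ j : Fin n, (X (r, j) : MvPolynomial (Fin m × Fin n) F) ∉ P := fun j hj =>
    (X_mem_span_X_image_iff _ (r, j)).1 (hPle hj) rfl
  rcases thm_4_1_contains F h2 hm (by omega) P hle with
    ⟨r', hr'⟩ | ⟨c, hc⟩ | ⟨r', s', c', d', -, -, -, hoff, -⟩
  · by_cases hrr : r = r'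
    · rw [Ideal.span_le]
      rintro g ⟨x, hx, rfl⟩
      exact hr' x.1 x.2 (fun h => hx (h.trans hrr.symm))
    · exact absurd (hr' r ⟨0, by omega⟩ hrr) (hnot _)
  · obtain ⟨d, hdc⟩ := exists_ne_of_two_le (by omega) c
    exact absurd (hc r d hdc) (hnot d)
  · obtain ⟨j, hjc, hjd⟩ := exists_ne_ne_of_three_le hn c' d'
    exact absurd (hoff r j fun h => h.2.elim hjc hjd) (hnot j)

/-- **Laubenbacher–Swanson 2000, Thm. 4.1, second half, type (2)** ("(2) if `m ≥ 3`, then `P` is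
generated by all the indeterminates in `n − 1` of the columns of `M`"): for `m ≥ 3` the ideal of
the variables off the column `c` is a minimal prime of `P₂(M)`.
[cite: LaubenbacherSwanson2000, Thm. 4.1 (arXiv text p0006 L9–22)] -/
theorem colIdeal_mem_minimalPrimes (h2 : (2 : F) ≠ 0) (hm : 3 ≤ m) (hn : 1 ≤ n) (c : Fin n) :
    Ideal.span ((fun x => (X x : MvPolynomial (Fin m × Fin n) F)) '' {x | x.2 ≠ c}) ∈
      (subpermIdeal F m n 2).minimalPrimes := by
  classical
  refine ⟨⟨isPrime_span_X_image _, subpermIdeal_two_le_colIdeal F c⟩, ?_⟩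
  rintro P ⟨hP, hle⟩ hPle
  haveI := hP
  have hnot : ∀ i : Fin m, (X (i, c) : MvPolynomial (Fin m × Fin n) F) ∉ P := fun i hi =>
    (X_mem_span_X_image_iff _ (i, c)).1 (hPle hi) rfl
  rcases thm_4_1_contains F h2 (by omega) hn P hle with
    ⟨r, hr⟩ | ⟨c', hc'⟩ | ⟨r', s', c', d', -, -, -, hoff, -⟩
  · obtain ⟨i, hir⟩ := exists_ne_of_two_le (by omega) r
    exact absurd (hr i c hir) (hnot i)
  · by_cases hcc : c = c'
    · rw [Ideal.span_le]
      rintro g ⟨x, hx, rfl⟩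
      exact hc' x.1 x.2 (fun h => hx (h.trans hcc.symm))
    · exact absurd (hc' ⟨0, by omega⟩ c hcc) (hnot _)
  · obtain ⟨i, hir, his⟩ := exists_ne_ne_of_three_le hm r' s'
    exact absurd (hoff i c fun h => h.1.elim hir his) (hnot i)

/-- **Laubenbacher–Swanson 2000, Thm. 4.1, second half, type (3)** ("(3) `P` is generated by the
permanent of one `2 × 2`-submatrix of `M` and all the entries of `M` outside of this submatrix …
each … is minimal over `P₂(M)`"): for `r ≠ s`, `c ≠ d` (so `m, n ≥ 2`) and `2 ≠ 0` in `F`, the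
type (3) ideal of the block `{r, s} × {c, d}` is a minimal prime of `P₂(M)`.
[cite: LaubenbacherSwanson2000, Thm. 4.1 (arXiv text p0006 L9–22)] -/
theorem blockIdeal_mem_minimalPrimes (h2 : (2 : F) ≠ 0) {r s : Fin m} {c d : Fin n} (hrs : r ≠ s)
    (hcd : c ≠ d) :
    Ideal.span (insert (X (r, c) * X (s, d) + X (r, d) * X (s, c) :
        MvPolynomial (Fin m × Fin n) F)
      ((fun x => (X x : MvPolynomial (Fin m × Fin n) F)) ''
        {x | ¬((x.1 = r ∨ x.1 = s) ∧ (x.2 = c ∨ x.2 = d))})) ∈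
      (subpermIdeal F m n 2).minimalPrimes := by
  classical
  have hm : 1 ≤ m := by have := r.isLt; omega
  have hn : 1 ≤ n := by have := c.isLt; omega
  refine ⟨⟨isPrime_blockIdeal hrs hcd, subpermIdeal_two_le_blockIdeal F⟩, ?_⟩
  rintro P ⟨hP, hle⟩ hPle
  haveI := hP
  have hnot : ∀ x : Fin m × Fin n, (x.1 = r ∨ x.1 = s) ∧ (x.2 = c ∨ x.2 = d) →
      (X x : MvPolynomial (Fin m × Fin n) F) ∉ P :=
    fun x hx hxP => X_notMem_blockIdeal hrs hcd hx (hPle hxP)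
  rcases thm_4_1_contains F h2 hm hn P hle with
    ⟨r', hr'⟩ | ⟨c', hc'⟩ | ⟨r', s', c', d', hrs', hcd', -, hoff, hper⟩
  · -- a block row `ρ ≠ r'` gives `X (ρ, c) ∈ P`
    by_cases hρ : r = r'
    · exact absurd (hr' s c (fun h => hrs (hρ.trans h.symm))) (hnot (s, c) ⟨Or.inr rfl, Or.inl rfl⟩)
    · exact absurd (hr' r c hρ) (hnot (r, c) ⟨Or.inl rfl, Or.inl rfl⟩)
  · by_cases hγ : c = c'
    · exact absurd (hc' r d (fun h => hcd (hγ.trans h.symm))) (hnot (r, d) ⟨Or.inl rfl, Or.inr rfl⟩)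
    · exact absurd (hc' r c hγ) (hnot (r, c) ⟨Or.inl rfl, Or.inl rfl⟩)
  · -- every block position lies in the block `{r', s'} × {c', d'}`, so the blocks coincide
    have hin : ∀ x : Fin m × Fin n, (x.1 = r ∨ x.1 = s) ∧ (x.2 = c ∨ x.2 = d) →
        (x.1 = r' ∨ x.1 = s') ∧ (x.2 = c' ∨ x.2 = d') := by
      intro x hx
      by_contra h
      exact hnot x hx (hoff x.1 x.2 h)
    have hr := (hin (r, c) ⟨Or.inl rfl, Or.inl rfl⟩).1
    have hs := (hin (s, c) ⟨Or.inr rfl, Or.inl rfl⟩).1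
    have hc := (hin (r, c) ⟨Or.inl rfl, Or.inl rfl⟩).2
    have hd := (hin (r, d) ⟨Or.inl rfl, Or.inr rfl⟩).2
    simp only at hr hs hc hd
    -- rows: `{r, s} = {r', s'}`; columns: `{c, d} = {c', d'}`
    have hrows : ∀ a : Fin m, (a = r' ∨ a = s') ↔ (a = r ∨ a = s) := by
      intro a
      rcases hr with hr | hr <;> rcases hs with hs | hs
      · exact absurd (hr.trans hs.symm) hrs
      · rw [hr, hs]
      · rw [hr, hs, or_comm]
      · exact absurd (hr.trans hs.symm) hrs
    have hcols : ∀ a : Fin n, (a = c' ∨ a = d') ↔ (a = c ∨ a = d) := by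
      intro a
      rcases hc with hc | hc <;> rcases hd with hd | hd
      · exact absurd (hc.trans hd.symm) hcd
      · rw [hc, hd]
      · rw [hc, hd, or_comm]
      · exact absurd (hc.trans hd.symm) hcd
    rw [Ideal.span_le]
    rintro g (rfl | ⟨x, hx, rfl⟩)
    · -- the block permanent of `(r', s'; c', d')` is the one of `(r, s; c, d)`
      rw [SetLike.mem_coe, ← blockPerm_eq_of_mem (F := F) ((hrows r').1 (Or.inl rfl))
        ((hrows s').1 (Or.inr rfl)) hrs' ((hcols c').1 (Or.inl rfl)) ((hcols d').1 (Or.inr rfl))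
        hcd']
      exact hper
    · exact hoff x.1 x.2 fun h => hx ⟨(hrows x.1).1 h.1, (hcols x.2).1 h.2⟩

/-- **Laubenbacher–Swanson 2000, Theorem 4.1 (complete classification of the minimal primes of
`P₂(M)`)** ("Let `m, n ≥ 2`.  Each of the prime ideals `P` of `R` minimal over `P₂(M)` is one of
the following: (1) if `n ≥ 3`, … all the indeterminates in `m − 1` of the rows of `M`; (2) if
`m ≥ 3`, … in `n − 1` of the columns of `M`; (3) … the permanent of one `2 × 2`-submatrix of `M`
and all the entries of `M` outside of this submatrix.  Moreover, each of the primes in (1), (2)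
and (3) is minimal over `P₂(M)`."), over a field with `2 ≠ 0` (the paper's standing
characteristic `≠ 2`). [cite: LaubenbacherSwanson2000, Thm. 4.1 (arXiv text p0006 L9–22, proof L24–105)] -/
theorem thm_4_1 (h2 : (2 : F) ≠ 0) (hm : 2 ≤ m) (hn : 2 ≤ n)
    (Q : Ideal (MvPolynomial (Fin m × Fin n) F)) :
    Q ∈ (subpermIdeal F m n 2).minimalPrimes ↔
      (3 ≤ n ∧ ∃ r : Fin m,
        Q = Ideal.span ((fun x => (X x : MvPolynomial (Fin m × Fin n) F)) '' {x | x.1 ≠ r})) ∨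
      (3 ≤ m ∧ ∃ c : Fin n,
        Q = Ideal.span ((fun x => (X x : MvPolynomial (Fin m × Fin n) F)) '' {x | x.2 ≠ c})) ∨
      (∃ (r s : Fin m) (c d : Fin n), r ≠ s ∧ c ≠ d ∧
        Q = Ideal.span (insert (X (r, c) * X (s, d) + X (r, d) * X (s, c) :
            MvPolynomial (Fin m × Fin n) F)
          ((fun x => (X x : MvPolynomial (Fin m × Fin n) F)) ''
            {x | ¬((x.1 = r ∨ x.1 = s) ∧ (x.2 = c ∨ x.2 = d))}))) := by
  classical
  constructor
  · intro hQ
    haveI := hQ.1.1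
    rcases thm_4_1_contains F h2 (by omega) (by omega) Q hQ.1.2 with
      ⟨r, hr⟩ | ⟨c, hc⟩ | ⟨r, s, c, d, hrs, hcd, -, hoff, hper⟩
    · -- `T1(r) ≤ Q`, `T1(r)` prime over `P₂`: `Q = T1(r)`; and then `n ≥ 3`
      have hle : Ideal.span ((fun x => (X x : MvPolynomial (Fin m × Fin n) F)) '' {x | x.1 ≠ r})
          ≤ Q := by
        rw [Ideal.span_le]
        rintro g ⟨x, hx, rfl⟩
        exact hr x.1 x.2 hx
      have hge := hQ.2 ⟨isPrime_span_X_image _, subpermIdeal_two_le_rowIdeal F r⟩ hle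
      have hQeq := le_antisymm hge hle
      refine Or.inl ⟨?_, r, hQeq⟩
      by_contra h3
      have hn2 : n = 2 := by omega
      obtain ⟨s, hsr⟩ := exists_ne_of_two_le hm r
      -- the type (3) ideal of the block `{r, s} × {0, 1}` is a prime over `P₂` inside `T1(r)`
      have h01 : (⟨0, by omega⟩ : Fin n) ≠ ⟨1, by omega⟩ := fun h => by
        have := congrArg Fin.val h; simp at this
      have hT3le : Ideal.span (insert
          (X (r, (⟨0, by omega⟩ : Fin n)) * X (s, (⟨1, by omega⟩ : Fin n)) +
            X (r, (⟨1, by omega⟩ : Fin n)) * X (s, (⟨0, by omega⟩ : Fin n)) :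
            MvPolynomial (Fin m × Fin n) F)
          ((fun x => (X x : MvPolynomial (Fin m × Fin n) F)) ''
            {x | ¬((x.1 = r ∨ x.1 = s) ∧
              (x.2 = (⟨0, by omega⟩ : Fin n) ∨ x.2 = (⟨1, by omega⟩ : Fin n)))})) ≤
          Ideal.span ((fun x => (X x : MvPolynomial (Fin m × Fin n) F)) '' {x | x.1 ≠ r}) := by
        rw [Ideal.span_le]
        rintro g (rfl | ⟨x, hx, rfl⟩)
        · exact Ideal.add_mem _
            (Ideal.mul_mem_left _ _ (Ideal.subset_span ⟨(s, _), hsr, rfl⟩))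
            (Ideal.mul_mem_left _ _ (Ideal.subset_span ⟨(s, _), hsr, rfl⟩))
        · refine Ideal.subset_span ⟨x, fun hx1 => hx ⟨Or.inl hx1, ?_⟩, rfl⟩
          exact eq_or_eq_of_eq_two hn2 x.2
      have hge' := hQ.2 ⟨isPrime_blockIdeal hsr.symm h01, subpermIdeal_two_le_blockIdeal F⟩
        (hT3le.trans hle)
      rw [hQeq] at hge'
      have hmem : (X (s, (⟨0, by omega⟩ : Fin n)) : MvPolynomial (Fin m × Fin n) F) ∈
          Ideal.span ((fun x => (X x : MvPolynomial (Fin m × Fin n) F)) '' {x | x.1 ≠ r}) :=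
        Ideal.subset_span ⟨(s, _), hsr, rfl⟩
      exact X_notMem_blockIdeal hsr.symm h01 (x := (s, ⟨0, by omega⟩)) ⟨Or.inr rfl, Or.inl rfl⟩
        (hge' hmem)
    · have hle : Ideal.span ((fun x => (X x : MvPolynomial (Fin m × Fin n) F)) '' {x | x.2 ≠ c})
          ≤ Q := by
        rw [Ideal.span_le]
        rintro g ⟨x, hx, rfl⟩
        exact hc x.1 x.2 hx
      have hge := hQ.2 ⟨isPrime_span_X_image _, subpermIdeal_two_le_colIdeal F c⟩ hle
      have hQeq := le_antisymm hge hle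
      refine Or.inr (Or.inl ⟨?_, c, hQeq⟩)
      by_contra h3
      have hm2 : m = 2 := by omega
      obtain ⟨d, hdc⟩ := exists_ne_of_two_le hn c
      have h01 : (⟨0, by omega⟩ : Fin m) ≠ ⟨1, by omega⟩ := fun h => by
        have := congrArg Fin.val h; simp at this
      have hT3le : Ideal.span (insert
          (X ((⟨0, by omega⟩ : Fin m), c) * X ((⟨1, by omega⟩ : Fin m), d) +
            X ((⟨0, by omega⟩ : Fin m), d) * X ((⟨1, by omega⟩ : Fin m), c) :
            MvPolynomial (Fin m × Fin n) F)
          ((fun x => (X x : MvPolynomial (Fin m × Fin n) F)) ''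
            {x | ¬((x.1 = (⟨0, by omega⟩ : Fin m) ∨ x.1 = (⟨1, by omega⟩ : Fin m)) ∧
              (x.2 = c ∨ x.2 = d))})) ≤
          Ideal.span ((fun x => (X x : MvPolynomial (Fin m × Fin n) F)) '' {x | x.2 ≠ c}) := by
        rw [Ideal.span_le]
        rintro g (rfl | ⟨x, hx, rfl⟩)
        · exact Ideal.add_mem _
            (Ideal.mul_mem_left _ _ (Ideal.subset_span ⟨(_, d), hdc, rfl⟩))
            (Ideal.mul_mem_right _ _ (Ideal.subset_span ⟨(_, d), hdc, rfl⟩))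
        · refine Ideal.subset_span ⟨x, fun hx2 => hx ⟨?_, Or.inl hx2⟩, rfl⟩
          exact eq_or_eq_of_eq_two hm2 x.1
      have hge' := hQ.2 ⟨isPrime_blockIdeal h01 hdc.symm, subpermIdeal_two_le_blockIdeal F⟩
        (hT3le.trans hle)
      rw [hQeq] at hge'
      have hmem : (X ((⟨0, by omega⟩ : Fin m), d) : MvPolynomial (Fin m × Fin n) F) ∈
          Ideal.span ((fun x => (X x : MvPolynomial (Fin m × Fin n) F)) '' {x | x.2 ≠ c}) :=
        Ideal.subset_span ⟨(_, d), hdc, rfl⟩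
      exact X_notMem_blockIdeal h01 hdc.symm (x := (⟨0, by omega⟩, d)) ⟨Or.inl rfl, Or.inr rfl⟩
        (hge' hmem)
    · have hle : Ideal.span (insert (X (r, c) * X (s, d) + X (r, d) * X (s, c) :
            MvPolynomial (Fin m × Fin n) F)
          ((fun x => (X x : MvPolynomial (Fin m × Fin n) F)) ''
            {x | ¬((x.1 = r ∨ x.1 = s) ∧ (x.2 = c ∨ x.2 = d))})) ≤ Q := by
        rw [Ideal.span_le]
        rintro g (rfl | ⟨x, hx, rfl⟩)
        · exact hper
        · exact hoff x.1 x.2 hx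
      have hge := hQ.2 ⟨isPrime_blockIdeal hrs hcd, subpermIdeal_two_le_blockIdeal F⟩ hle
      exact Or.inr (Or.inr ⟨r, s, c, d, hrs, hcd, le_antisymm hge hle⟩)
  · rintro (⟨hn3, r, rfl⟩ | ⟨hm3, c, rfl⟩ | ⟨r, s, c, d, hrs, hcd, rfl⟩)
    · exact rowIdeal_mem_minimalPrimes F h2 (by omega) hn3 r
    · exact colIdeal_mem_minimalPrimes F h2 hm3 (by omega) c
    · exact blockIdeal_mem_minimalPrimes F h2 hrs hcd

end Minimal

/-! ### §E. Remark 4.2, type (3): the exact height `mn − 3` -/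

section Height

variable (F : Type*) [Field F] {m n : ℕ}

/-- Krull's height theorem, packaged: an ideal inside a proper ideal generated by a finite set
`T` has height `≤ |T|`. [folklore] -/
private theorem height_le_card_of_le_span'' {A : Type*} [CommRing A] [IsNoetherianRing A]
    {I : Ideal A} {T : Finset A} (hle : I ≤ Ideal.span (T : Set A))
    (hT : Ideal.span (T : Set A) ≠ ⊤) : I.height ≤ T.card := by
  obtain ⟨p, hp⟩ := Ideal.nonempty_minimalPrimes hT
  exact (Ideal.height_mono (hle.trans hp.1.2)).trans
    (Ideal.height_le_card_of_mem_minimalPrimes_span_finset hp)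

/-- **Laubenbacher–Swanson 2000, Remark 4.2, type (3)** ("type (3) primes have height
`mn − 4 + 1 = mn − 3`"): the type (3) ideal of a block `{r, s} × {c, d}` (`r ≠ s`, `c ≠ d`) has
height exactly `mn − 3` (it is prime; Krull's bound by its `mn − 3` generators, and
`rem_4_2_block_ge`). [cite: LaubenbacherSwanson2000, Rem. 4.2 (arXiv text p0006 L107–112)] -/
theorem rem_4_2_block {r s : Fin m} {c d : Fin n} (hrs : r ≠ s) (hcd : c ≠ d) :
    (Ideal.span (insert (X (r, c) * X (s, d) + X (r, d) * X (s, c) :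
        MvPolynomial (Fin m × Fin n) F)
      ((fun x => (X x : MvPolynomial (Fin m × Fin n) F)) ''
        {x | ¬((x.1 = r ∨ x.1 = s) ∧ (x.2 = c ∨ x.2 = d))}))).height = (m * n - 3 : ℕ) := by
  classical
  haveI := isPrime_blockIdeal (F := F) hrs hcd
  apply le_antisymm
  · -- Krull: the generators are `per` and the `mn − 4` off-block variables
    set off : Finset (Fin m × Fin n) :=
      Finset.univ.filter fun x => ¬((x.1 = r ∨ x.1 = s) ∧ (x.2 = c ∨ x.2 = d)) with hoff
    set T : Finset (MvPolynomial (Fin m × Fin n) F) :=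
      insert (X (r, c) * X (s, d) + X (r, d) * X (s, c))
        (off.image fun x => (X x : MvPolynomial (Fin m × Fin n) F)) with hT
    have hcoe : (T : Set (MvPolynomial (Fin m × Fin n) F)) =
        insert (X (r, c) * X (s, d) + X (r, d) * X (s, c) : MvPolynomial (Fin m × Fin n) F)
          ((fun x => (X x : MvPolynomial (Fin m × Fin n) F)) ''
            {x | ¬((x.1 = r ∨ x.1 = s) ∧ (x.2 = c ∨ x.2 = d))}) := by
      rw [hT, Finset.coe_insert, Finset.coe_image]
      congr 1
      refine congrArg _ (Set.ext fun x => ?_)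
      rw [hoff, Finset.coe_filter]
      simp only [Finset.mem_univ, true_and, Set.mem_setOf_eq]
    have hcardoff : off.card ≤ m * n - 4 := by
      have hB : 4 ≤ (Finset.univ.filter fun x : Fin m × Fin n =>
          (x.1 = r ∨ x.1 = s) ∧ (x.2 = c ∨ x.2 = d)).card := by
        calc 4 = (({r, s} : Finset (Fin m)) ×ˢ ({c, d} : Finset (Fin n))).card := by
              rw [Finset.card_product, Finset.card_pair hrs, Finset.card_pair hcd]
          _ ≤ _ := Finset.card_le_card fun x hx => by
              rw [Finset.mem_product, Finset.mem_insert, Finset.mem_singleton, Finset.mem_insert,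
                Finset.mem_singleton] at hx
              exact Finset.mem_filter.2 ⟨Finset.mem_univ _, hx⟩
      have hsum := Finset.card_filter_add_card_filter_not
        (s := (Finset.univ : Finset (Fin m × Fin n)))
        (p := fun x : Fin m × Fin n => (x.1 = r ∨ x.1 = s) ∧ (x.2 = c ∨ x.2 = d))
      rw [Finset.card_univ, Fintype.card_prod, Fintype.card_fin, Fintype.card_fin] at hsum
      rw [hoff]
      omega
    have hcardT : T.card ≤ m * n - 3 := by
      have h2m : 2 ≤ m := Fin.nontrivial_iff_two_le.1 ⟨⟨r, s, hrs⟩⟩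
      have h2n : 2 ≤ n := Fin.nontrivial_iff_two_le.1 ⟨⟨c, d, hcd⟩⟩
      have h4 : 4 ≤ m * n := by nlinarith
      rw [hT]
      refine (Finset.card_insert_le _ _).trans ?_
      have := Finset.card_image_le (s := off) (f := fun x => (X x : MvPolynomial (Fin m × Fin n) F))
      omega
    have hne : Ideal.span (T : Set (MvPolynomial (Fin m × Fin n) F)) ≠ ⊤ := by
      rw [hcoe]; exact Ideal.IsPrime.ne_top'
    refine le_trans ?_ (show ((T.card : ℕ) : ℕ∞) ≤ ((m * n - 3 : ℕ) : ℕ∞) by exact_mod_cast hcardT)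
    rw [← hcoe]
    exact height_le_card_of_le_span'' le_rfl hne
  · exact rem_4_2_block_ge F hrs hcd _
      (fun x hx => Ideal.subset_span (Set.mem_insert_of_mem _ ⟨x, hx, rfl⟩))
      (Ideal.subset_span (Set.mem_insert _ _))

end Height

/-! ### §F. Corollary 4.3 (heights of minimal primes; the printed exception list corrected) -/

section Cor43

variable (F : Type*) [Field F] {m n : ℕ}

/-- **Corollary 4.3 AS PRINTED is not reconciled at `(m, n) = (2, 3)`** — kernel witness: over a
field with `2 ≠ 0`, EVERY minimal prime of `P₂(2 × 3)` has height `3` (type (1): `(m−1)n = 3`;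
type (3): `mn − 3 = 3`; type (2) needs `m ≥ 3`), so `R/P₂(M)` is equidimensional there, whereas
the arXiv text (p0006 L120–125) reads "If `(m,n) ≠ (2,2)` and `(m,n) ≠ (3,3)`, then `R/P₂(M)` is not
equidimensional, hence not Cohen–Macaulay".  Typed ≠ printed: the exception list of Cor. 4.3 is
incomplete — `(2,3)` and `(3,2)` are equidimensional (heights `3, 3`); flagged for the
PRINT-ERRATA registry (candidate A48, Tier B: a side remark; Thm. 4.1, Rem. 4.2, Cor. 4.4 are
unaffected). [cite: LaubenbacherSwanson2000, Cor. 4.3 (arXiv text p0006 L120–125)] -/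
theorem cor_4_3_asPrinted_counterexample (h2 : (2 : F) ≠ 0)
    (P : Ideal (MvPolynomial (Fin 2 × Fin 3) F)) (hP : P ∈ (subpermIdeal F 2 3 2).minimalPrimes) :
    P.height = 3 := by
  rcases (thm_4_1 F h2 le_rfl (by norm_num) P).1 hP with
    ⟨-, r, rfl⟩ | ⟨h3, -⟩ | ⟨r, s, c, d, hrs, hcd, rfl⟩
  · rw [rem_4_2_rows]; norm_num
  · omega
  · rw [rem_4_2_block F hrs hcd]; norm_num

/-- **Laubenbacher–Swanson 2000, Corollary 4.3, with the corrected exception list** (two minimal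
primes of different heights, the tree having no `equidimensional` notion; "hence not
Cohen–Macaulay" NOT typed): for `m, n ≥ 2` with `(m, n) ∉ {(2,2), (3,3), (2,3), (3,2)}` and `2 ≠ 0`
in `F`, `P₂(M)` has two minimal primes of different heights — for `n ≥ 4` a row type
(`(m−1)n`) and a block type (`mn − 3`), for `m ≥ 4` a column type (`m(n−1)`) and a block type.
Printed hypothesis: "`(m,n) ≠ (2,2)` and `(m,n) ≠ (3,3)`" (insufficient, see
`cor_4_3_asPrinted_counterexample`). [cite: LaubenbacherSwanson2000, Cor. 4.3 (arXiv text p0006 L120–125)] -/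
theorem cor_4_3 (h2 : (2 : F) ≠ 0) (hm : 2 ≤ m) (hn : 2 ≤ n)
    (hmn : ¬((m = 2 ∧ n = 2) ∨ (m = 3 ∧ n = 3) ∨ (m = 2 ∧ n = 3) ∨ (m = 3 ∧ n = 2))) :
    ∃ P Q : Ideal (MvPolynomial (Fin m × Fin n) F),
      P ∈ (subpermIdeal F m n 2).minimalPrimes ∧ Q ∈ (subpermIdeal F m n 2).minimalPrimes ∧
        P.height ≠ Q.height := by
  have hr01 : (⟨0, by omega⟩ : Fin m) ≠ ⟨1, by omega⟩ := fun h => by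
    have := congrArg Fin.val h; simp at this
  have hc01 : (⟨0, by omega⟩ : Fin n) ≠ ⟨1, by omega⟩ := fun h => by
    have := congrArg Fin.val h; simp at this
  have hblock := blockIdeal_mem_minimalPrimes F h2 hr01 hc01
  have hbh := rem_4_2_block F hr01 hc01
  by_cases hn4 : 4 ≤ n
  · refine ⟨_, _, rowIdeal_mem_minimalPrimes F h2 (by omega) (by omega) ⟨0, by omega⟩, hblock, ?_⟩
    have hle : n ≤ m * n := Nat.le_mul_of_pos_left n (by omega)
    rw [rem_4_2_rows, hbh, Ne, Nat.cast_inj, Nat.sub_one_mul]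
    omega
  by_cases hm4 : 4 ≤ m
  · refine ⟨_, _, colIdeal_mem_minimalPrimes F h2 (by omega) (by omega) ⟨0, by omega⟩, hblock, ?_⟩
    have hle : m ≤ m * n := Nat.le_mul_of_pos_right m (by omega)
    rw [rem_4_2_cols, hbh, Ne, Nat.cast_inj, Nat.mul_sub_one]
    omega
  · exfalso
    apply hmn
    omega

end Cor43

end LaubenbacherSwanson2000

end Literature.Computability.AlgebraicComplexity
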